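import Summits.Ventures.YMGap.RobustBall.FreeEnergyLawTorus
import Summits.Ventures.YMGap.RobustBall.FreeEnergyLawFatou
import Summits.Ventures.YMGap.RobustBall.PlaquetteLawTwoSided
import HarnessLib

/-!
# Robust ball (Y2), area-law side — THE STRONG-COUPLING FREE-ENERGY LAW: `f(β) + #planes·N·β = #planes·(V₀β²/2)·e^{∓O(β)}`
# at EVERY coupling

HONEST FRAMING: venture file of the cell `pub-ymgap` (QuantumFields programme), track ROBUST-BALL, seat rb-p2 (g7).  LATTICE
statements about the free energy density per site `f(β) = lim_L |Λ_L|⁻¹ log Z_{Λ_L, β}` of Wilson's `SU(N)` lattice gauge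
theory (tree `freeEnergyDensity d ρ β`, Wave-0 normalisation `S = ∑_p (N − Re tr ρ(U_p))`, torus sizes `L + 1 → ∞`; it
EXISTS at every coupling by the tree's `exists_hasFreeEnergyDensity_holds`, Friedli–Velenik Thm. 3.6).  WHAT IS NEW (a new
observable for the cell's statement; hypothesis-free, every `N ≥ 2`, every `d ≥ 2`, every `β ≥ 0`):

  ★★★ `freeEnergyDensity_two_sided`:
  `#planes · (V₀β²/2) · e^{−2(d−1)(2d+1)Nβ} ≤ f(β) + #planes·N·β ≤ #planes · (V₀β²/2) · e^{8(d−1)²Nβ}`,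

`#planes = d(d−1)/2`, `V₀ = charVariance ρ = ∫ (Re tr)² dHaar` (`1` for `SU(2)`, `1/2` for `N ≥ 3`, rb-p2 g5
`HaarSecondMoments`).  Here `f(β) + #planes·N·β = lim |Λ|⁻¹ log ∫ e^{β ∑_p Re tr U_p} dHaar` is the interaction pressure and
`#planes·V₀β²/2` its LEADING strong-coupling term (one Gaussian plaquette; for `SU(2)` at tree coupling `β_W/2`:
`6 · β_W²/8 = (3/4)β_W²`, the `β_W²`-coefficient of `6 log(2I₁(β_W)/β_W)`), so the law says: THE FREE ENERGY EQUALS ITS LEADING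
STRONG-COUPLING TERM WITHIN A FACTOR `e^{∓O(β)}` AT EVERY COUPLING.  Cells: `su2_freeEnergy_two_sided_dim4`
(`(3/4)β_W² e^{−54β_W} ≤ f(β_W/2) + 6β_W ≤ (3/4)β_W² e^{72β_W}`), its logarithmic and `ε–β₀` forms
(`su2_log_freeEnergy_two_sided_dim4`, `su2_freeEnergy_ratio_limit_dim4`: `(f(β_W/2) + 6β_W)/((3/4)β_W²) → 1`, `β₀ = log(1+ε)/72`),
`d = 3` (`su2_freeEnergy_two_sided_dim3`: `(3/8)β_W² e^{[−28, 32]β_W}`), every `N ≥ 3` (`suN_freeEnergy_two_sided_dim4`: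
`(3/2)β² e^{[−54N, 72N]β}`).

MECHANISM (no expansion, no reflection positivity): (1) `FreeEnergyLawTorus`: `d/ds |Λ|⁻¹ log Z_L(s) = ∑_{i<j}⟨Re tr U_{(0,ij)}⟩_{L,s}
− #planes·N` and the fundamental theorem of calculus at finite volume; (2) rb-p2 g6's MEAN-PLAQUETTE LAW for infinite-volume limit
states (`PlaquetteLaw.rectExpectation_one_one_le_exp`, `StringTensionExplicit.rectExpectation_one_one_ge_linear`; all planes
equal, `PlaquettePositivity.integral_plaquetteObs_eq`) bounds the plane sum of EVERY limit state at coupling `s` inside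
`#planes · sV₀ · [e^{−2(d−1)(2d+1)Ns}, e^{8(d−1)²Ns}]` (`planeSum_limitState_two_sided`); (3) compactness transfers these bounds
to the torus plane sums eventually in `L` (`eventually_planeSum_le`); (4) Fatou on `[0, β]` (`FreeEnergyLawFatou`) and the
existence of the thermodynamic limit give the law (`freeEnergyDensity_two_sided_integral`), and `∫₀^β s e^{±cs} ds` against
`e^{±cβ}β²/2` the displayed form.

WHAT IT IS NOT: the `O(β)` exponents are one-link artefacts (the strong-coupling SERIES of `f`, e.g. Balian–Drouffe–Itzykson's
higher orders, is not claimed); the window is vacuous-but-true at large `β` (the weak-coupling end is Chatterjee's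
`f(β) ∼ c log β + K`, Literature `chatterjee_freeEnergyDensity`); nothing continuum / spectral / Clay.  0 compute.

References: R. Balian, J.-M. Drouffe, C. Itzykson, Phys. Rev. D 11 (1975) 2104 (strong-coupling expansion of the free
energy); K. Osterwalder, E. Seiler, Ann. Phys. 110 (1978) 440 (analyticity at strong coupling); S. Friedli, Y. Velenik,
*Statistical Mechanics of Lattice Systems* (2017) §3.2; S. Chatterjee, J. Funct. Anal. 271 (2016) 2944 (weak coupling, for
comparison only).  Everything here is proved. [folklore]
-/

noncomputable section

open MeasureTheory Filter Topology Finset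
open Literature.MathematicalPhysics.QuantumLattice
open Literature.MathematicalPhysics.QuantumFieldTheory hiding ZdEdge

namespace Summit.Ventures.YMGap.RobustBall

namespace FreeEnergyLaw

/-! ### The law for `G ≅ SU(N)`: assembly -/

section Model

variable {d N : ℕ} {G : Type*} [Group G] [TopologicalSpace G] [IsTopologicalGroup G]
  [CompactSpace G] [MeasurableSpace G] [BorelSpace G] [SecondCountableTopology G] [T2Space G]
  (ρ : G →* Matrix (Fin N) (Fin N) ℂ)

omit [TopologicalSpace G] [IsTopologicalGroup G] [CompactSpace G] [BorelSpace G] [SecondCountableTopology G]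
  [T2Space G] in
/-- The plaquette expectation of a state is `N` times the `1 × 1` Wilson-loop expectation in the normalised character:
`∫ Re tr ρ(U_p) dμ = N · W_μ(1,1)` (`p` the plaquette at the origin of the `(0,1)` plane). [folklore] -/
theorem integral_plaquetteObs_eq_mul_rectExpectation [NeZero d] (hN : 1 ≤ N) (μ : Measure (LGConfig d G)) :
    ∫ U, plaquetteObs ρ (0 : Literature.Probability.LatticeModels.Site d) 0 1 U ∂μ =
      N * rectExpectation μ (fun g => normalisedCharacter N (ρ g)) 0 1 1 1 := by
  have hN0 : (N : ℝ) ≠ 0 := by exact_mod_cast (show N ≠ 0 by omega)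
  have hline : ∀ (U : LGConfig d G) (i : Fin d) (x : Literature.Probability.LatticeModels.Site d),
      walkHolonomy U (lineWalk i 1 x) = U (x, i) := fun U i x => by
    rw [lineWalk, walkHolonomy_cons, walkHolonomy_copy, lineWalk, walkHolonomy_copy, walkHolonomy_nil, mul_one,
      dartHolonomy_add_single]
  have hhol : ∀ U : LGConfig d G, walkHolonomy U (rectWalk 0 0 1 1 1) =
      plaquetteHolonomyZd U (0 : Literature.Probability.LatticeModels.Site d) 0 1 := fun U => by
    simp only [rectWalk, walkHolonomy_append, walkHolonomy_copy, walkHolonomy_reverse, hline, Nat.cast_one,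
      plaquetteHolonomyZd, mul_assoc]
  unfold rectExpectation loopExpectation wilsonLoopObs
  simp only [normalisedCharacter, plaquetteObs, hhol]
  rw [integral_const_mul, ← mul_assoc, mul_inv_cancel₀ hN0, one_mul]

/-- **The plane sum of the plaquette expectations of a limit state, two-sided** (rb-p2 g6's mean-plaquette law summed over
the `#planes` coordinate planes, all equal by the symmetry of limit states): for `G ≅ SU(N)`, `N ≥ 2`, `d ≥ 2`, `s ≥ 0` and
`μ ∈ infiniteVolumeLimitPoints ρ s`,
`#planes · sV₀ e^{−2(d−1)(2d+1)Ns} ≤ ∑_{i<j} ∫ Re tr ρ(U_{(0,i,j)}) dμ ≤ #planes · sV₀ e^{8(d−1)²Ns}`. [folklore] -/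
theorem planeSum_limitState_two_sided [NeZero d] (hρ : IsSpecialUnitaryModel ρ) (hN : 2 ≤ N) (hd : 2 ≤ d) {s : ℝ}
    (hs : 0 ≤ s) {μ : Measure (LGConfig d G)} (hμ : μ ∈ infiniteVolumeLimitPoints ρ s) :
    (Fintype.card {q : Fin d × Fin d // q.1 < q.2} : ℝ) *
        (PlaquetteLowerBound.charVariance ρ * s * Real.exp (-(2 * ((d : ℝ) - 1) * (2 * (d : ℝ) + 1) * N * s))) ≤
      ∑ q : {q : Fin d × Fin d // q.1 < q.2},
        ∫ U, plaquetteObs ρ (0 : Literature.Probability.LatticeModels.Site d) q.1.1 q.1.2 U ∂μ ∧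
    ∑ q : {q : Fin d × Fin d // q.1 < q.2},
        ∫ U, plaquetteObs ρ (0 : Literature.Probability.LatticeModels.Site d) q.1.1 q.1.2 U ∂μ ≤
      (Fintype.card {q : Fin d × Fin d // q.1 < q.2} : ℝ) *
        (PlaquetteLowerBound.charVariance ρ * s * Real.exp (8 * ((d : ℝ) - 1) ^ 2 * N * s)) := by
  have hN0 : (0 : ℝ) < N := by exact_mod_cast (show 0 < N by omega)
  have hsum : ∑ q : {q : Fin d × Fin d // q.1 < q.2},
      ∫ U, plaquetteObs ρ (0 : Literature.Probability.LatticeModels.Site d) q.1.1 q.1.2 U ∂μ =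
      (Fintype.card {q : Fin d × Fin d // q.1 < q.2} : ℝ) *
        ∫ U, plaquetteObs ρ (0 : Literature.Probability.LatticeModels.Site d) 0 1 U ∂μ := by
    rw [Finset.sum_congr rfl fun q _ =>
      PlaquettePositivity.integral_plaquetteObs_eq ρ hρ.1 hd hμ 0 (ne_of_lt q.2), Finset.sum_const, Finset.card_univ,
      nsmul_eq_mul]
  have heq := integral_plaquetteObs_eq_mul_rectExpectation (d := d) ρ (by omega) μ
  have hlow := StringTensionExplicit.rectExpectation_one_one_ge_linear ρ hρ hN hd hs hμ
  have hup := PlaquetteLaw.rectExpectation_one_one_le_exp ρ hρ hN hd hs hμ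
  have hD : (0 : ℝ) ≤ (Fintype.card {q : Fin d × Fin d // q.1 < q.2} : ℝ) := Nat.cast_nonneg _
  rw [hsum, heq]
  constructor
  · refine mul_le_mul_of_nonneg_left ?_ hD
    have h := mul_le_mul_of_nonneg_left hlow hN0.le
    calc PlaquetteLowerBound.charVariance ρ * s * Real.exp (-(2 * ((d : ℝ) - 1) * (2 * (d : ℝ) + 1) * N * s))
        = N * (s * PlaquetteLowerBound.charVariance ρ / N *
            Real.exp (-(2 * ((d : ℝ) - 1) * (2 * (d : ℝ) + 1) * N * s))) := by field_simp
      _ ≤ _ := h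
  · refine mul_le_mul_of_nonneg_left ?_ hD
    have h := mul_le_mul_of_nonneg_left hup hN0.le
    calc _ ≤ N * (s * PlaquetteLowerBound.charVariance ρ / N * Real.exp (8 * ((d : ℝ) - 1) ^ 2 * N * s)) := h
      _ = PlaquetteLowerBound.charVariance ρ * s * Real.exp (8 * ((d : ℝ) - 1) ^ 2 * N * s) := by field_simp

omit [SecondCountableTopology G] [T2Space G] in
/-- The torus plane sums are bounded uniformly in the volume and the coupling. [folklore] -/
theorem exists_abs_planeSum_le (hρ : Continuous ρ) :
    ∃ C : ℝ, 0 ≤ C ∧ ∀ (L : ℕ) (s : ℝ), |∑ q : {q : Fin d × Fin d // q.1 < q.2},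
        wilsonExpectation (L := L + 1) ρ s
          (toTorusObservable (L + 1) (plaquetteObs ρ (0 : Literature.Probability.LatticeModels.Site d) q.1.1 q.1.2))| ≤
      C := by
  choose Cq hCq using fun q : {q : Fin d × Fin d // q.1 < q.2} =>
    exists_abs_plaquetteObs_le (G := G) ρ hρ (0 : Literature.Probability.LatticeModels.Site d) q.1.1 q.1.2
  have hCq0 : ∀ q, 0 ≤ Cq q := fun q => (abs_nonneg _).trans (hCq q (fun _ => 1))
  refine ⟨∑ q, Cq q, Finset.sum_nonneg fun q _ => hCq0 q, fun L s => ?_⟩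
  haveI := isProbabilityMeasure_wilsonMeasure (d := d) (L := L + 1) ρ hρ s
  refine (Finset.abs_sum_le_sum_abs _ _).trans (Finset.sum_le_sum fun q _ => ?_)
  unfold wilsonExpectation
  have h := norm_integral_le_of_norm_le_const (μ := wilsonMeasure (d := d) (L := L + 1) ρ s)
    (f := toTorusObservable (L + 1) (plaquetteObs ρ (0 : Literature.Probability.LatticeModels.Site d) q.1.1 q.1.2))
    (C := Cq q) (Eventually.of_forall fun U => by
      rw [Real.norm_eq_abs, toTorusObservable_apply]; exact hCq q _)
  rwa [Real.norm_eq_abs, probReal_univ, mul_one] at h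

/-- ★★ **THE STRONG-COUPLING FREE-ENERGY LAW, integral form.**  For `G ≅ SU(N)`, `N ≥ 2`, `d ≥ 2` and every `β ≥ 0`, the free
energy density per site `f(β) = lim_L |Λ_L|⁻¹ log Z_{Λ_L, β}` (Wave-0 normalisation `S = ∑_p (N − Re tr U_p)`) satisfies
`∫₀^β #planes·V₀ s e^{−2(d−1)(2d+1)Ns} ds ≤ f(β) + #planes·N·β ≤ ∫₀^β #planes·V₀ s e^{8(d−1)²Ns} ds`. [folklore] -/
theorem freeEnergyDensity_two_sided_integral (hρ : IsSpecialUnitaryModel ρ) (hN : 2 ≤ N) (hd : 2 ≤ d) {β : ℝ}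
    (hβ : 0 ≤ β) :
    (∫ s in (0 : ℝ)..β, (Fintype.card {q : Fin d × Fin d // q.1 < q.2} : ℝ) * PlaquetteLowerBound.charVariance ρ * s *
        Real.exp (-(2 * ((d : ℝ) - 1) * (2 * (d : ℝ) + 1) * N * s))) ≤
      freeEnergyDensity d ρ β + (Fintype.card {q : Fin d × Fin d // q.1 < q.2} : ℝ) * N * β ∧
    freeEnergyDensity d ρ β + (Fintype.card {q : Fin d × Fin d // q.1 < q.2} : ℝ) * N * β ≤
      ∫ s in (0 : ℝ)..β, (Fintype.card {q : Fin d × Fin d // q.1 < q.2} : ℝ) * PlaquetteLowerBound.charVariance ρ * s *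
        Real.exp (8 * ((d : ℝ) - 1) ^ 2 * N * s) := by
  haveI : NeZero d := ⟨by omega⟩
  set D : ℝ := (Fintype.card {q : Fin d × Fin d // q.1 < q.2} : ℝ) with hDdef
  have hD : 0 ≤ D := Nat.cast_nonneg _
  have hV : 0 ≤ PlaquetteLowerBound.charVariance ρ := (PlaquetteLowerBound.charVariance_pos ρ hρ.1 (by omega)).le
  have hN0 : (0 : ℝ) ≤ N := Nat.cast_nonneg _
  -- the torus plane sums `A L s`
  set A : ℕ → ℝ → ℝ := fun L s => ∑ q : {q : Fin d × Fin d // q.1 < q.2},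
      wilsonExpectation (L := L + 1) ρ s
        (toTorusObservable (L + 1) (plaquetteObs ρ (0 : Literature.Probability.LatticeModels.Site d) q.1.1 q.1.2))
    with hA
  obtain ⟨C₁, hC₁, hAC⟩ := exists_abs_planeSum_le (d := d) ρ hρ.1
  -- convergence of `∫₀^β A L` to `f(β) + D N β`
  have hP : Tendsto (fun L : ℕ => (((L + 1 : ℕ) : ℝ) ^ d)⁻¹ * torusLogPartition d ρ β (L + 1)) atTop
      (𝓝 (freeEnergyDensity d ρ β)) :=
    hasFreeEnergyDensity_freeEnergyDensity ρ (exists_hasFreeEnergyDensity_holds (d := d) ρ hρ.1 β)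
  have hlim : Tendsto (fun L : ℕ => ∫ s in (0 : ℝ)..β, A L s) atTop (𝓝 (freeEnergyDensity d ρ β + D * N * β)) := by
    have h := hP.add_const (D * N * β)
    refine h.congr fun L => ?_
    rw [torusPressure_eq_integral (d := d) ρ hρ.1 L β]
    ring
  have hAcont : ∀ L, Continuous (A L) := fun L => continuous_planeSum (d := d) ρ hρ.1 L
  constructor
  · -- lower bound
    set Lo : ℝ → ℝ := fun s => D * PlaquetteLowerBound.charVariance ρ * s *
        Real.exp (-(2 * ((d : ℝ) - 1) * (2 * (d : ℝ) + 1) * N * s)) with hLo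
    have hLoc : Continuous Lo := by
      rw [hLo]
      exact ((continuous_const.mul continuous_id).mul (Real.continuous_exp.comp (continuous_const.mul continuous_id).neg))
    have hLo0 : ∀ s ∈ Set.Icc (0 : ℝ) β, 0 ≤ Lo s := fun s hs => by
      rw [hLo]; exact mul_nonneg (mul_nonneg (mul_nonneg hD hV) hs.1) (Real.exp_pos _).le
    refine integral_le_of_forall_eventually_ge (C := C₁) hβ hAcont hLoc.continuousOn
      (fun L s _ => (abs_le.1 (hAC L s)).1) (fun s hs => by linarith [hLo0 s hs]) (fun s hs ε hε => ?_) hlim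
    have hev := eventually_le_planeSum (d := d) ρ hρ.1 (s := s) (ε := ε)
      (B := Lo s) (fun μ hμ => by
        rw [hLo]
        have h := (planeSum_limitState_two_sided (d := d) ρ hρ hN hd hs.1 hμ).1
        calc D * PlaquetteLowerBound.charVariance ρ * s * Real.exp (-(2 * ((d : ℝ) - 1) * (2 * (d : ℝ) + 1) * N * s))
            = D * (PlaquetteLowerBound.charVariance ρ * s *
                Real.exp (-(2 * ((d : ℝ) - 1) * (2 * (d : ℝ) + 1) * N * s))) := by ring
          _ ≤ _ := h) hε
    exact hev
  · -- upper bound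
    set Up : ℝ → ℝ := fun s => D * PlaquetteLowerBound.charVariance ρ * s * Real.exp (8 * ((d : ℝ) - 1) ^ 2 * N * s)
      with hUp
    have hUpc : Continuous Up := by
      rw [hUp]
      exact ((continuous_const.mul continuous_id).mul (Real.continuous_exp.comp (continuous_const.mul continuous_id)))
    have hUpC : ∀ s ∈ Set.Icc (0 : ℝ) β, Up s ≤ C₁ + D * PlaquetteLowerBound.charVariance ρ * β *
        Real.exp (8 * ((d : ℝ) - 1) ^ 2 * N * β) := by
      intro s hs
      rw [hUp]
      have h1 : D * PlaquetteLowerBound.charVariance ρ * s ≤ D * PlaquetteLowerBound.charVariance ρ * β :=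
        mul_le_mul_of_nonneg_left hs.2 (mul_nonneg hD hV)
      have h2 : Real.exp (8 * ((d : ℝ) - 1) ^ 2 * N * s) ≤ Real.exp (8 * ((d : ℝ) - 1) ^ 2 * N * β) :=
        Real.exp_le_exp.2 (mul_le_mul_of_nonneg_left hs.2 (by positivity))
      have h3 := mul_le_mul h1 h2 (Real.exp_pos _).le (mul_nonneg (mul_nonneg hD hV) hβ)
      linarith
    refine le_integral_of_forall_eventually_le
      (C := C₁ + D * PlaquetteLowerBound.charVariance ρ * β * Real.exp (8 * ((d : ℝ) - 1) ^ 2 * N * β)) hβ hAcont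
      hUpc.continuousOn (fun L s _ => ((abs_le.1 (hAC L s)).2.trans (by
        have : 0 ≤ D * PlaquetteLowerBound.charVariance ρ * β * Real.exp (8 * ((d : ℝ) - 1) ^ 2 * N * β) := by
          positivity
        linarith))) hUpC (fun s hs ε hε => ?_) hlim
    have hev := eventually_planeSum_le (d := d) ρ hρ.1 (s := s) (ε := ε)
      (B := Up s) (fun μ hμ => by
        rw [hUp]
        have h := (planeSum_limitState_two_sided (d := d) ρ hρ hN hd hs.1 hμ).2
        calc _ ≤ _ := h
          _ = D * PlaquetteLowerBound.charVariance ρ * s * Real.exp (8 * ((d : ℝ) - 1) ^ 2 * N * s) := by ring) hε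
    exact hev

/-- ★★★ **THE STRONG-COUPLING FREE-ENERGY LAW.**  For `G ≅ SU(N)`, `N ≥ 2`, `d ≥ 2` and EVERY `β ≥ 0`: the free energy density
per site of lattice Yang–Mills (which exists at every coupling, `exists_hasFreeEnergyDensity_holds`) equals its LEADING
strong-coupling term within a factor `e^{∓O(β)}`,
`#planes · (V₀β²/2) · e^{−2(d−1)(2d+1)Nβ} ≤ f(β) + #planes·N·β ≤ #planes · (V₀β²/2) · e^{8(d−1)²Nβ}`
(`#planes = d(d−1)/2`, `V₀ = charVariance ρ = ∫ (Re tr)² dHaar`; `f(β) + #planes·N·β = lim |Λ|⁻¹ log ∫ e^{β ∑_p Re tr U_p}`).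
[folklore] -/
theorem freeEnergyDensity_two_sided (hρ : IsSpecialUnitaryModel ρ) (hN : 2 ≤ N) (hd : 2 ≤ d) {β : ℝ} (hβ : 0 ≤ β) :
    (Fintype.card {q : Fin d × Fin d // q.1 < q.2} : ℝ) * (PlaquetteLowerBound.charVariance ρ * β ^ 2 / 2) *
        Real.exp (-(2 * ((d : ℝ) - 1) * (2 * (d : ℝ) + 1) * N * β)) ≤
      freeEnergyDensity d ρ β + (Fintype.card {q : Fin d × Fin d // q.1 < q.2} : ℝ) * N * β ∧
    freeEnergyDensity d ρ β + (Fintype.card {q : Fin d × Fin d // q.1 < q.2} : ℝ) * N * β ≤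
      (Fintype.card {q : Fin d × Fin d // q.1 < q.2} : ℝ) * (PlaquetteLowerBound.charVariance ρ * β ^ 2 / 2) *
        Real.exp (8 * ((d : ℝ) - 1) ^ 2 * N * β) := by
  have h := freeEnergyDensity_two_sided_integral (d := d) ρ hρ hN hd hβ
  have hV : 0 ≤ PlaquetteLowerBound.charVariance ρ := (PlaquetteLowerBound.charVariance_pos ρ hρ.1 (by omega)).le
  have hD : (0 : ℝ) ≤ (Fintype.card {q : Fin d × Fin d // q.1 < q.2} : ℝ) := Nat.cast_nonneg _
  have ha : 0 ≤ (Fintype.card {q : Fin d × Fin d // q.1 < q.2} : ℝ) * PlaquetteLowerBound.charVariance ρ := mul_nonneg hD hV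
  have hc₁ : (0 : ℝ) ≤ 2 * ((d : ℝ) - 1) * (2 * (d : ℝ) + 1) * N := by
    have : (2 : ℝ) ≤ d := by exact_mod_cast hd
    have : (0 : ℝ) ≤ N := Nat.cast_nonneg _
    have h1 : (0 : ℝ) ≤ (d : ℝ) - 1 := by linarith
    positivity
  have hc₂ : (0 : ℝ) ≤ 8 * ((d : ℝ) - 1) ^ 2 * N := by positivity
  have hlow := le_integral_mul_exp_neg (β := β) ha hc₁ hβ
  have hup := integral_mul_exp_le (β := β) ha hc₂ hβ
  constructor
  · refine le_trans (le_of_eq ?_) (hlow.trans (le_trans (le_of_eq ?_) h.1))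
    · rw [show -(2 * ((d : ℝ) - 1) * (2 * (d : ℝ) + 1) * N * β) = -(2 * ((d : ℝ) - 1) * (2 * (d : ℝ) + 1) * N) * β
        by ring, ← neg_mul]
      ring_nf
    · refine intervalIntegral.integral_congr fun s _ => ?_
      ring_nf
  · refine h.2.trans (le_trans (le_of_eq ?_) (hup.trans (le_of_eq ?_)))
    · refine intervalIntegral.integral_congr fun s _ => ?_
      ring_nf
    · ring_nf

end Model

/-! ### Cells: `SU(2)` and `SU(N)`, `d = 4` and `d = 3` -/

section Cells

/-- ★★★ **SU(2), `d = 4`: THE STRONG-COUPLING FREE-ENERGY LAW** — for EVERY `β_W ≥ 0`, with `f = freeEnergyDensity 4 χ₂ (β_W/2)`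
(tree functional, Wave-0 normalisation `S = ∑_p (2 − Re tr U_p)`, tree coupling `β_W/2`):
`f(β_W/2) + 6β_W = (3/4)β_W² · e^{θ}`, `θ ∈ [−54β_W, 72β_W]`, i.e. `(3/4) β_W² e^{−54β_W} ≤ f(β_W/2) + 6β_W ≤ (3/4) β_W² e^{72β_W}`:
the free energy density per site equals its leading strong-coupling term `(3/4)β_W²` (`= 6` plaquettes per site `× β_W²/8`, the
`β_W²`-coefficient of `log(2I₁(β_W)/β_W)`) within `e^{∓O(β_W)}`. [folklore] -/
theorem su2_freeEnergy_two_sided_dim4 {βW : ℝ} (hβ : 0 ≤ βW) :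
    3 / 4 * βW ^ 2 * Real.exp (-(54 * βW)) ≤ freeEnergyDensity 4 (fundamentalRep (Fin 2)) (βW / 2) + 6 * βW ∧
      freeEnergyDensity 4 (fundamentalRep (Fin 2)) (βW / 2) + 6 * βW ≤ 3 / 4 * βW ^ 2 * Real.exp (72 * βW) := by
  have hρ := TorusAreaLaw.isSpecialUnitaryModel_fundamentalRep 2
  have h := freeEnergyDensity_two_sided (d := 4) (fundamentalRep (Fin 2)) hρ le_rfl (by norm_num)
    (by positivity : (0 : ℝ) ≤ βW / 2)
  have hD : (Fintype.card {q : Fin 4 × Fin 4 // q.1 < q.2} : ℝ) = 6 := by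
    rw [show Fintype.card {q : Fin 4 × Fin 4 // q.1 < q.2} = 6 by rfl]; norm_num
  rw [HaarSecondMoments.charVariance_su2, hD] at h
  push_cast at h
  obtain ⟨h1, h2⟩ := h
  constructor
  · have e1 : 3 / 4 * βW ^ 2 * Real.exp (-(54 * βW)) =
        6 * (1 * (βW / 2) ^ 2 / 2) * Real.exp (-(2 * ((4 : ℝ) - 1) * (2 * (4 : ℝ) + 1) * 2 * (βW / 2))) := by ring_nf
    have e2 : freeEnergyDensity 4 (fundamentalRep (Fin 2)) (βW / 2) + 6 * 2 * (βW / 2) =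
        freeEnergyDensity 4 (fundamentalRep (Fin 2)) (βW / 2) + 6 * βW := by ring
    rw [e1, ← e2]; exact h1
  · have e1 : 3 / 4 * βW ^ 2 * Real.exp (72 * βW) =
        6 * (1 * (βW / 2) ^ 2 / 2) * Real.exp (8 * ((4 : ℝ) - 1) ^ 2 * 2 * (βW / 2)) := by ring_nf
    have e2 : freeEnergyDensity 4 (fundamentalRep (Fin 2)) (βW / 2) + 6 * 2 * (βW / 2) =
        freeEnergyDensity 4 (fundamentalRep (Fin 2)) (βW / 2) + 6 * βW := by ring
    rw [e1, ← e2]; exact h2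

/-- ★ **SU(2), `d = 4`, logarithmic form**: for every `β_W > 0`,
`−54β_W ≤ log(f(β_W/2) + 6β_W) − log((3/4)β_W²) ≤ 72β_W`. [folklore] -/
theorem su2_log_freeEnergy_two_sided_dim4 {βW : ℝ} (hβ : 0 < βW) :
    -(54 * βW) ≤ Real.log (freeEnergyDensity 4 (fundamentalRep (Fin 2)) (βW / 2) + 6 * βW) - Real.log (3 / 4 * βW ^ 2) ∧
      Real.log (freeEnergyDensity 4 (fundamentalRep (Fin 2)) (βW / 2) + 6 * βW) - Real.log (3 / 4 * βW ^ 2) ≤ 72 * βW := by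
  obtain ⟨h1, h2⟩ := su2_freeEnergy_two_sided_dim4 hβ.le
  have hu : 0 < 3 / 4 * βW ^ 2 := by positivity
  have hlowpos : 0 < 3 / 4 * βW ^ 2 * Real.exp (-(54 * βW)) := by positivity
  have hFpos : 0 < freeEnergyDensity 4 (fundamentalRep (Fin 2)) (βW / 2) + 6 * βW := lt_of_lt_of_le hlowpos h1
  constructor
  · have h := Real.log_le_log hlowpos h1
    rw [Real.log_mul hu.ne' (Real.exp_pos _).ne', Real.log_exp] at h
    linarith
  · have h := Real.log_le_log hFpos h2
    rw [Real.log_mul hu.ne' (Real.exp_pos _).ne', Real.log_exp] at h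
    linarith

/-- ★★ **SU(2), `d = 4`: `(f(β_W/2) + 6β_W) / ((3/4)β_W²) → 1` as `β_W → 0⁺`** with an explicit rate:
`∀ ε > 0 ∃ β₀ > 0 ∀ 0 < β_W ≤ β₀, |(f(β_W/2) + 6β_W)/((3/4)β_W²) − 1| ≤ ε` (`β₀ = log(1+ε)/72`). [folklore] -/
theorem su2_freeEnergy_ratio_limit_dim4 (ε : ℝ) (hε : 0 < ε) :
    ∃ β₀ : ℝ, 0 < β₀ ∧ ∀ βW : ℝ, 0 < βW → βW ≤ β₀ →
      |(freeEnergyDensity 4 (fundamentalRep (Fin 2)) (βW / 2) + 6 * βW) / (3 / 4 * βW ^ 2) - 1| ≤ ε := by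
  have hL : 0 < Real.log (1 + ε) := Real.log_pos (by linarith)
  refine ⟨Real.log (1 + ε) / 72, by positivity, fun βW hβ hβ0 => ?_⟩
  set F : ℝ := freeEnergyDensity 4 (fundamentalRep (Fin 2)) (βW / 2) + 6 * βW with hFdef
  obtain ⟨h1, h2⟩ := su2_log_freeEnergy_two_sided_dim4 hβ
  obtain ⟨h1', -⟩ := su2_freeEnergy_two_sided_dim4 hβ.le
  have hu : 0 < 3 / 4 * βW ^ 2 := by positivity
  have hFpos : 0 < F := lt_of_lt_of_le (by positivity) h1'
  have h72 : 72 * βW ≤ Real.log (1 + ε) := by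
    have := mul_le_mul_of_nonneg_left hβ0 (by norm_num : (0 : ℝ) ≤ 72)
    linarith
  have hratio : F / (3 / 4 * βW ^ 2) = Real.exp (Real.log F - Real.log (3 / 4 * βW ^ 2)) := by
    rw [Real.exp_sub, Real.exp_log hFpos, Real.exp_log hu]
  rw [hratio, abs_le]
  constructor
  · have hx := Real.add_one_le_exp (Real.log F - Real.log (3 / 4 * βW ^ 2))
    have hlog_le : Real.log (1 + ε) ≤ ε := by
      have := Real.log_le_sub_one_of_pos (by linarith : (0 : ℝ) < 1 + ε)
      linarith
    linarith
  · have hx : Real.exp (Real.log F - Real.log (3 / 4 * βW ^ 2)) ≤ Real.exp (Real.log (1 + ε)) :=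
      Real.exp_le_exp.2 (by linarith)
    rw [Real.exp_log (by linarith)] at hx
    linarith

/-- ★ **SU(2), `d = 3`: `(3/8) β_W² e^{−28β_W} ≤ f(β_W/2) + 3β_W ≤ (3/8) β_W² e^{32β_W}`** for every `β_W ≥ 0` (three planes).
[folklore] -/
theorem su2_freeEnergy_two_sided_dim3 {βW : ℝ} (hβ : 0 ≤ βW) :
    3 / 8 * βW ^ 2 * Real.exp (-(28 * βW)) ≤ freeEnergyDensity 3 (fundamentalRep (Fin 2)) (βW / 2) + 3 * βW ∧
      freeEnergyDensity 3 (fundamentalRep (Fin 2)) (βW / 2) + 3 * βW ≤ 3 / 8 * βW ^ 2 * Real.exp (32 * βW) := by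
  have hρ := TorusAreaLaw.isSpecialUnitaryModel_fundamentalRep 2
  have h := freeEnergyDensity_two_sided (d := 3) (fundamentalRep (Fin 2)) hρ le_rfl (by norm_num)
    (by positivity : (0 : ℝ) ≤ βW / 2)
  have hD : (Fintype.card {q : Fin 3 × Fin 3 // q.1 < q.2} : ℝ) = 3 := by
    rw [show Fintype.card {q : Fin 3 × Fin 3 // q.1 < q.2} = 3 by rfl]; norm_num
  rw [HaarSecondMoments.charVariance_su2, hD] at h
  push_cast at h
  obtain ⟨h1, h2⟩ := h
  constructor
  · have e1 : 3 / 8 * βW ^ 2 * Real.exp (-(28 * βW)) =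
        3 * (1 * (βW / 2) ^ 2 / 2) * Real.exp (-(2 * ((3 : ℝ) - 1) * (2 * (3 : ℝ) + 1) * 2 * (βW / 2))) := by ring_nf
    have e2 : freeEnergyDensity 3 (fundamentalRep (Fin 2)) (βW / 2) + 3 * 2 * (βW / 2) =
        freeEnergyDensity 3 (fundamentalRep (Fin 2)) (βW / 2) + 3 * βW := by ring
    rw [e1, ← e2]; exact h1
  · have e1 : 3 / 8 * βW ^ 2 * Real.exp (32 * βW) =
        3 * (1 * (βW / 2) ^ 2 / 2) * Real.exp (8 * ((3 : ℝ) - 1) ^ 2 * 2 * (βW / 2)) := by ring_nf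
    have e2 : freeEnergyDensity 3 (fundamentalRep (Fin 2)) (βW / 2) + 3 * 2 * (βW / 2) =
        freeEnergyDensity 3 (fundamentalRep (Fin 2)) (βW / 2) + 3 * βW := by ring
    rw [e1, ← e2]; exact h2

/-- ★ **Every `N ≥ 3`, `d = 4`: `(3/2) β² e^{−54Nβ} ≤ f(β) + 6Nβ ≤ (3/2) β² e^{72Nβ}`** for every tree coupling `β ≥ 0`
(`V₀ = 1/2`; in Wilson's normalisation `β = β_W/N`, the leading term is `(3/2)β² = 3β_W²/(2N²)`). [folklore] -/
theorem suN_freeEnergy_two_sided_dim4 {N : ℕ} (hN : 3 ≤ N) {β : ℝ} (hβ : 0 ≤ β) :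
    3 / 2 * β ^ 2 * Real.exp (-(54 * N * β)) ≤ freeEnergyDensity 4 (fundamentalRep (Fin N)) β + 6 * N * β ∧
      freeEnergyDensity 4 (fundamentalRep (Fin N)) β + 6 * N * β ≤ 3 / 2 * β ^ 2 * Real.exp (72 * N * β) := by
  have hρ := TorusAreaLaw.isSpecialUnitaryModel_fundamentalRep N
  have h := freeEnergyDensity_two_sided (d := 4) (fundamentalRep (Fin N)) hρ (by omega) (by norm_num) hβ
  have hD : (Fintype.card {q : Fin 4 × Fin 4 // q.1 < q.2} : ℝ) = 6 := by
    rw [show Fintype.card {q : Fin 4 × Fin 4 // q.1 < q.2} = 6 by rfl]; norm_num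
  rw [HaarSecondMoments.charVariance_suN hN, hD] at h
  push_cast at h
  obtain ⟨h1, h2⟩ := h
  constructor
  · have e1 : 3 / 2 * β ^ 2 * Real.exp (-(54 * N * β)) =
        6 * (1 / 2 * β ^ 2 / 2) * Real.exp (-(2 * ((4 : ℝ) - 1) * (2 * (4 : ℝ) + 1) * N * β)) := by ring_nf
    rw [e1]; exact h1
  · have e1 : 3 / 2 * β ^ 2 * Real.exp (72 * N * β) =
        6 * (1 / 2 * β ^ 2 / 2) * Real.exp (8 * ((4 : ℝ) - 1) ^ 2 * N * β) := by ring_nf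
    rw [e1]; exact h2

end Cells

end FreeEnergyLaw

end Summit.Ventures.YMGap.RobustBall
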